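import Summits.Ventures.MM22.Rank333.Root21Kernel
import Literature.Computability.AlgebraicComplexity.MatMul333ExponentThreshold
import HarnessLib

/-!
# MM22 venture — corollary of K2: over `𝔽₂`, only a 21-product `3 × 3` scheme could still beat Strassen by itself

Cell `pub-mm22` (MatrixMultiplication venture; HOME `run/shared/lean/pub/pub-mm22/`; seat p1 g6; suggested by lit-1 g9,
adopted by lead g5 2026-08-23T08:09:48Z). HONEST FRAMING: a ten-line corollary about the RECURSION EXPONENT `log₃ r` of a
single `⟨3,3,3⟩` scheme with `r` products over `𝔽₂`, combining the cell's kernel theorem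
`twentyone_le_tensorRank_matMulTensor_three_F2` (`21 ≤ R_𝔽₂(⟨3,3,3⟩)`, K2, `Root21Kernel.lean`) with Laderman's printed
threshold remark "`log₂ 7 ≈ log₃ 21.8`" as typed in `MatMul333ExponentThreshold.lean`
(`logb_two_7_lt_logb_three_of_le`, `logb_three_lt_logb_two_7_of_le`). It says NOTHING about `ω`, nothing about other
fields, and nothing about whether a 21-product scheme exists (the window over `𝔽₂` is `[21, 23]`); no summit claim.
-/

namespace Summit.Ventures.MM22

open Literature.Computability.AlgebraicComplexity

/-- **Over `𝔽₂`, a `3 × 3` scheme whose recursion exponent `log₃ r` beats Strassen's `log₂ 7` must have EXACTLY `r = 21`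
products**: `r ≥ 21` by the kernel theorem `21 ≤ R_𝔽₂(⟨3,3,3⟩)` (K2), and `r ≤ 21` because `log₂ 7 < log₃ r` for every
`r ≥ 22` (Laderman 1976, p. 126, as typed). A statement about one scheme's recursion exponent only. -/
theorem rank_eq_21_of_strassen_beating_F2 {r : ℕ} (hr : tensorRank (matMulTensor (ZMod 2) 3 3 3) ≤ r)
    (hω : Real.logb 3 r < Real.logb 2 7) : r = 21 := by
  have h21 : 21 ≤ r := le_trans twentyone_le_tensorRank_matMulTensor_three_F2 hr
  by_contra hne
  have h22 : 22 ≤ r := by omega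
  exact absurd hω (not_lt.mpr (logb_two_7_lt_logb_three_of_le h22).le)

/-- The same as an equivalence: for a product count `r` that some `⟨3,3,3⟩` scheme over `𝔽₂` attains
(`R_𝔽₂(⟨3,3,3⟩) ≤ r`), the recursion exponent `log₃ r` is below Strassen's `log₂ 7` iff `r = 21`. -/
theorem strassen_beating_iff_eq_21_F2 {r : ℕ} (hr : tensorRank (matMulTensor (ZMod 2) 3 3 3) ≤ r) :
    Real.logb 3 r < Real.logb 2 7 ↔ r = 21 := by
  refine ⟨rank_eq_21_of_strassen_beating_F2 hr, fun h => ?_⟩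
  subst h
  exact logb_three_lt_logb_two_7_of_le (by norm_num) le_rfl

end Summit.Ventures.MM22
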